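import Literature.ModelTheory.FiniteModelTheory.XorGraphParityDecoding
import Literature.ModelTheory.FiniteModelTheory.DegreeParitySystemFP
import Literature.ModelTheory.FiniteModelTheory.CountingWidthHamiltonicityProofs
import HarnessLib

/-!
# `PolylogBarrier`, step 1: hard pairs for the degree-parity class at every large order

Helper file of route `PneNP/SymmetryBudget`, item `PolylogBarrier` (stmt-PneNP-2147). The witness
language of the barrier is the class `ParityFP.paritySolvableClass` of finite graphs whose
degree-parity system is solvable over `𝔽₂` (`Literature/…/DegreeParitySystem*.lean`: isomorphism-
closed, polynomial-time decidable). Here: for every `n ≥ 3` beyond the expander threshold of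
`XorHamGame.exists_boundaryExpander` and every order `N ≥ 25 n` there are graphs `H₁`, `H₂` on `Fin N`
with `⟨N, H₁⟩ ∈ paritySolvableClass`, `⟨N, H₂⟩ ∉ paritySolvableClass` and `H₂ ≡^{C^k} H₁` whenever
`3k ≤ ⌊radius n / 4⌋` (`exists_parity_hard_pair`): the encoding graphs `XVert.xgraph vr 0`,
`XVert.xgraph vr b` (`b` unsolvable, `XorHamGame.exists_unsat`) of an expanding 3XOR system, padded
by `N - 25n` isolated vertices and moved to `Fin N` — the pattern of `XorHamGame.hard_pair`.
-/

-- `Summit.PneNP.PneNP.…` duplicates `PneNP` BY DESIGN (single-problem summit).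
set_option linter.dupNamespace false

namespace Summit.PneNP.PneNP.Theorems

open Literature.ModelTheory.FiniteModelTheory Literature.ModelTheory.FiniteModelTheory.XVert
  Literature.Computability.MetaComplexity

/-- Membership of a padded, relabelled encoding graph in the degree-parity class is solvability of
the degree-parity system of the encoding graph (isolated padding and isomorphisms do not matter).
[folklore] -/
theorem mem_paritySolvableClass_map_sum_iff {n m r N : ℕ} (vr : Fin m → Fin 3 → Fin n)
    (b : Fin m → ZMod 2) (e : XVert n m ⊕ Fin r ≃ Fin N) [DecidableRel (xgraph vr b).Adj] :
    (⟨N, (xgraph vr b ⊕g (⊥ : SimpleGraph (Fin r))).map e⟩ : FinGraph) ∈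
        ParityFP.paritySolvableClass ↔ ParitySolvable (xgraph vr b) := by
  classical
  rw [ParityFP.mem_paritySolvableClass_iff,
    ← paritySolvable_iff_of_iso (SimpleGraph.Iso.map e (xgraph vr b ⊕g (⊥ : SimpleGraph (Fin r))))]
  refine paritySolvable_iff_of_embedding (f := (Sum.inl : XVert n m → XVert n m ⊕ Fin r))
    Sum.inl_injective (fun a c => SimpleGraph.sum_adj_inl) ?_
  rintro (a | w) hv z
  · exact absurd rfl (hv a)
  · cases z <;> simp

/-- **Hard pairs at every large order.** For `n ≥ 3` beyond the expander threshold and `N ≥ 25 n`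
there are `H₁ H₂ : SimpleGraph (Fin N)` with `H₁` in the degree-parity class, `H₂` not, and
`H₂ ≡^{C^k} H₁` for all `k` with `3 k ≤ radius n / 4`. [folklore] -/
theorem exists_parity_hard_pair {n N : ℕ} (hn3 : 3 ≤ n)
    (hbig : 32 * (7 / 4) * XorHamGame.cB ^ 4 < (n : ℝ)) (hN : 25 * n ≤ N) :
    ∃ H₁ H₂ : SimpleGraph (Fin N), (⟨N, H₁⟩ : FinGraph) ∈ ParityFP.paritySolvableClass ∧
      (⟨N, H₂⟩ : FinGraph) ∉ ParityFP.paritySolvableClass ∧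
      ∀ k : ℕ, 3 * k ≤ XorHamGame.radius n / 4 → CkEquiv k H₂ H₁ := by
  classical
  obtain ⟨c, hexp⟩ := XorHamGame.exists_boundaryExpander hn3 hbig
  obtain ⟨b, hb⟩ := XorHamGame.exists_unsat (show n < 2 * n by omega) (XorHamGame.vrOf c)
  set vr := XorHamGame.vrOf c with hvr
  have hinj : ∀ u, Function.Injective (vr u) := XorHamGame.vrOf_injective c
  have hcard : Fintype.card (XVert n (2 * n) ⊕ Fin (N - 25 * n)) = N := by
    rw [Fintype.card_sum, card_xVert, Fintype.card_fin]; omega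
  let e : XVert n (2 * n) ⊕ Fin (N - 25 * n) ≃ Fin N := Fintype.equivFinOfCardEq hcard
  let G₁ := xgraph vr 0 ⊕g (⊥ : SimpleGraph (Fin (N - 25 * n)))
  let G₂ := xgraph vr b ⊕g (⊥ : SimpleGraph (Fin (N - 25 * n)))
  refine ⟨G₁.map e, G₂.map e, ?_, ?_, fun k hk => ?_⟩
  · exact (mem_paritySolvableClass_map_sum_iff vr 0 e).2 (paritySolvable_xgraph_zero hinj)
  · intro h
    obtain ⟨x, hx⟩ := (paritySolvable_xgraph_iff hinj).1 ((mem_paritySolvableClass_map_sum_iff vr b e).1 h)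
    exact hb x hx
  · -- the game: `2 · 2 · (s/4) ≤ 1 · s` and `3k ≤ s/4`
    by_cases hs : 1 ≤ XorHamGame.radius n
    · have hK : 2 * 2 * (XorHamGame.radius n / 4) ≤ 1 * XorHamGame.radius n := by omega
      have hck := ckEquiv_xgraph hinj hs one_pos (XorHamGame.expansion_nat hexp) hK hk b
      exact (hck.sum (CkEquiv.refl (⊥ : SimpleGraph (Fin (N - 25 * n))) k)).iso_congr
        (SimpleGraph.Iso.map e G₂) (SimpleGraph.Iso.map e G₁)
    · have hk0 : k = 0 := by omega
      subst hk0
      exact CkEquiv.zero _ _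

end Summit.PneNP.PneNP.Theorems
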